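import Mathlib
import Summits.MatrixMultiplication.Statement
import Summits.MatrixMultiplication.MatrixMultiplication.Theorems.GraphEquationsCubicSpecimen

/-!
# The cubic specimen, positive half: order two in one round, order one in two (`GraphEquations`, M78b)

Decomp-mm node «GraphEquations» (lens 5); attacked leaf `MultiplicityReduction`
(stmt-MatrixMultiplication-27806); target of the node, VERBATIM: `_root_.MatrixMultiplication`.

Companion of `GraphEquationsCubicSpecimen` (M78a: `¬ KernelFieldClauseDeg 4 1` — no kernel field of
the cubic specimen `t₀ = f_{p₀} + α f_{p₁}`, `t₁ = f_{p₁} c_{p₁}² + α f_{p₀} + 2 f_{p₀} f_{p₁}`,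
`t_i = f_{p_i}` reaches order `1` in ONE round).  Here the base-QUADRATIC kernel field
`v = (α, −1, 0, …)` (`cubicDir`; its cost plays no role) is followed exactly, in fibre coordinates:

* `polarDeriv_cubicDir_cubicG`: `D_v G₁ + 2 G₀ = −3 F₁²`, `D_v G₀ = 0`;
* `polarDeriv_polarDeriv_cubicDir_cubicG_one`: `D_v D_v G₁ = 6 F₁`;
* `cubic_one_round_order_two`: every system containing the `v`-deflation of a realisation of the
  specimen is ideal-initially-isolated to ORDER `2` over EVERY base pair (initial forms
  `F₀ + α(y)F₁`, `−3F₁²`, `F_{p_i}` isolate `0`);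
* `cubic_two_rounds_order_one`: after TWO rounds along `v`, order `1` over every base pair
  (`6 f_{p₁}` joins the ideal);
* `degree_four_kernelField_orders`: the summary — at degree `4`, one round: order `1` refuted
  (`K ≤ 1`), order `2` attained on this specimen; `KernelFieldClauseDeg 4 2 → ω₄ = ω` (M76) remains
  the live one-round dial.

Why two rounds is the ceiling of the phenomenon at degree `4` (informal remark, not formalised here): a
degree-`≤ 4` member of `I(Γ)` has `F`-degree `≤ 3` with CONSTANT cubic coefficients, so third
derivatives along fields are scalars — a masked direction is seen by a quadratic part (one round),
by a cubic part (two rounds), or by nothing (then the system is not correct).  No `sorry`.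

Sources: Leykin–Verschelde–Zhao, TCS 359 (2006) [doi:10.1016/j.tcs.2006.02.018], Thm 3.1;
[BurgisserClausenShokrollahi1997, §7.1, Problem 16.3].
-/

set_option linter.dupNamespace false

noncomputable section
open scoped BigOperators

namespace Summit.MatrixMultiplication.MatrixMultiplication.Theorems.GraphEquations

open MvPolynomial Matrix Literature.Computability.AlgebraicComplexity
open Literature.Computability.AlgebraicComplexity.ArithCircuit

variable {n : ℕ}

/-! ## The negative half in canonical-set form -/

/-- The same in the CANONICAL form of the clause (M76 `forall_deflatesTo_idealInitIsolatedAt_iff`) of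
M78a `cubic_one_round_not_order_one`: the ideal `(T(E) ∪ D_μ T(E))` is initially isolated to order `1` over no base pair. -/
theorem cubic_one_round_not_order_one_set (h2 : 2 ≤ n * n) {E : EqSystem n}
    (hto : ∀ j ∈ E.tests, ∃ i, E.testPoly j = cubicTest h2 i)
    (hfrom : ∀ i, ∃ j ∈ E.tests, E.testPoly j = cubicTest h2 i)
    (μ : Fin n × Fin n → MvPolynomial (MatMulVars n) ℂ)
    (hker : ∀ j ∈ E.tests, derivC μ (E.testPoly j) ∈ graphIdeal n) (y : MatMulVars n → ℂ) :
    ¬ IdealInitIsolatedSet (E.testSet ∪ derivC μ '' E.testSet) 1 y := fun h => by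
  obtain ⟨E', -, hD, hnot⟩ := cubic_one_round_not_order_one h2 hto hfrom μ hker
  exact hnot y ((E.forall_deflatesTo_idealInitIsolatedAt_iff μ 1 y).2 h E' hD)

/-! ## Derivatives along `v` -/

/-- `D_γ` is compatible with subtraction and negation (local helpers). -/
theorem polarDeriv_neg' {σ R : Type*} [CommRing R] [Fintype σ] [DecidableEq σ] (γ : σ → R)
    (P : MvPolynomial σ R) : polarDeriv γ (-P) = -polarDeriv γ P := by
  rw [← neg_one_mul P, ← C_1, ← C_neg, polarDeriv_C_mul, C_neg, C_1, neg_one_mul]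

/-- `D_v G₁ + 2 G₀ = −3 F₁²` and `D_v G₀ = 0` (fibre coordinates, exact identities). -/
theorem polarDeriv_cubicDir_cubicG (h2 : 2 ≤ n * n) :
    polarDeriv (cubicDir h2) (cubicG h2 ⟨1, by omega⟩) + 2 * cubicG h2 ⟨0, by omega⟩ =
        -(3 * X (chainPos n ⟨1, by omega⟩) ^ 2) ∧
      polarDeriv (cubicDir h2) (cubicG h2 ⟨0, by omega⟩) = 0 := by
  classical
  constructor
  · simp only [cubicG, show (1 : ℕ) ≠ 0 from by norm_num, if_false, if_true, polarDeriv_add, polarDeriv_X, sq,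
      polarDeriv_mul, polarDeriv_C, polarDeriv_ofNat, zero_mul, zero_add, cubicDir_chainPos, map_neg, map_one]
    ring
  · simp only [cubicG, if_true, polarDeriv_add, polarDeriv_X, polarDeriv_mul, polarDeriv_C, zero_mul, zero_add,
      cubicDir_chainPos, show (1 : ℕ) ≠ 0 from by norm_num, if_false, map_neg, map_one]
    ring

/-- `D_v D_v G₁ = 6 F₁`. -/
theorem polarDeriv_polarDeriv_cubicDir_cubicG_one (h2 : 2 ≤ n * n) :
    polarDeriv (cubicDir h2) (polarDeriv (cubicDir h2) (cubicG h2 ⟨1, by omega⟩)) =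
      6 * X (chainPos n ⟨1, by omega⟩) := by
  classical
  obtain ⟨h1, h0⟩ := polarDeriv_cubicDir_cubicG h2
  have h1' : polarDeriv (cubicDir h2) (cubicG h2 ⟨1, by omega⟩) =
      -(3 * X (chainPos n ⟨1, by omega⟩) ^ 2) - 2 * cubicG h2 ⟨0, by omega⟩ := by rw [← h1]; ring
  rw [h1', polarDeriv_sub', polarDeriv_neg', polarDeriv_ofNat_mul, polarDeriv_ofNat_mul, h0, mul_zero, sub_zero,
    sq, polarDeriv_mul, polarDeriv_X, cubicDir_chainPos]
  simp only [show (1 : ℕ) ≠ 0 from by norm_num, if_false, if_true, map_neg, map_one]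
  ring

/-- Degree-one components of the fibre variables (local helpers). -/
theorem homogeneousComponent_one_X' (q : Fin n × Fin n) : homogeneousComponent 1 (X q : FPoly n) = X q := by
  rw [homogeneousComponent_of_mem ((mem_homogeneousSubmodule _ _).2 (isHomogeneous_X _ q)), if_pos rfl]

/-- Homogeneous components of `F_q²`. -/
theorem homogeneousComponent_X_pow_two (q : Fin n × Fin n) (j : ℕ) :
    homogeneousComponent j ((X q : FPoly n) ^ 2) = if j = 2 then X q ^ 2 else 0 := by
  rw [homogeneousComponent_of_mem ((mem_homogeneousSubmodule _ _).2 ((isHomogeneous_X _ q).pow 2))]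

/-- Tests of a system lie in the span of its test family (local helper). -/
theorem EqSystem.mem_span_tests_of_mem (E : EqSystem n) {t : MvPolynomial (GraphVars n) ℂ}
    (h : ∃ j ∈ E.tests, E.testPoly j = t) :
    t ∈ Ideal.span (Set.range fun o : Fin E.tests.length => E.testPoly (E.tests.get o)) := by
  obtain ⟨j, hj, rfl⟩ := h
  obtain ⟨o, ho⟩ := List.get_of_mem hj
  exact Ideal.subset_span ⟨o, congrArg E.testPoly ho⟩

/-- **ONE ROUND ALONG `v` REACHES ORDER TWO** over every base pair, in every system containing the
deflation: the family `t₀`, `D_v t₁ + 2 t₀ = −3 f_{p₁}²`, `t_i` has initial forms `F₀ + α(y)F₁`,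
`−3F₁²`, `F_{p_i}`, which isolate `0`. -/
theorem cubic_one_round_order_two (h2 : 2 ≤ n * n) {E : EqSystem n}
    (hfrom : ∀ i, ∃ j ∈ E.tests, E.testPoly j = cubicTest h2 i)
    {E' : EqSystem n} (hD : E.DeflatesTo (cubicDir h2) E') (y : MatMulVars n → ℂ) :
    E'.IdealInitIsolatedAt 2 y := by
  classical
  have i0lt : 0 < n * n := by omega
  have i1lt : 1 < n * n := by omega
  obtain ⟨hG1, -⟩ := polarDeriv_cubicDir_cubicG h2
  have hG1' : polarDeriv (cubicDir h2) (cubicG h2 ⟨1, i1lt⟩) + 2 * cubicG h2 ⟨0, i0lt⟩ =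
      C (-3) * X (chainPos n ⟨1, i1lt⟩) ^ 2 := by
    rw [hG1, map_neg, map_ofNat]; ring
  -- the family: slot `1` carries `D_v t₁ + 2 t₀`, the other slots the tests themselves
  refine ⟨n * n, fun i => if i.val = 1 then derivC (cubicDir h2) (cubicTest h2 ⟨1, i1lt⟩) + 2 * cubicTest h2 ⟨0, i0lt⟩
      else cubicTest h2 i, fun i => ?_, fun i => if i.val = 1 then 2 else 1,
    fun i => if i.val = 1 then C (-3) * X (chainPos n ⟨1, i1lt⟩) ^ 2 else cubicG h2 i, fun i => ?_, fun i => ?_,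
    fun i j hj => ?_, fun F₀ hF => ?_⟩
  · -- membership in the test ideal of `E'`
    dsimp only
    split_ifs with h1
    · refine Ideal.add_mem _ (E'.mem_span_tests_of_mem ?_) (Ideal.mul_mem_left _ _ (E'.mem_span_tests_of_mem ?_))
      · obtain ⟨j, hj, hji⟩ := hfrom ⟨1, i1lt⟩
        obtain ⟨j', hj', h'⟩ := hD.2 j hj
        exact ⟨j', hj', by rw [h', hji]⟩
      · obtain ⟨j, hj, hji⟩ := hfrom ⟨0, i0lt⟩
        obtain ⟨j', hj', h'⟩ := hD.1 j hj
        exact ⟨j', hj', h'.trans hji⟩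
    · obtain ⟨j, hj, hji⟩ := hfrom i
      obtain ⟨j', hj', h'⟩ := hD.1 j hj
      exact E'.mem_span_tests_of_mem ⟨j', hj', h'.trans hji⟩
  · show (if i.val = 1 then 2 else 1) ≤ 2
    split_ifs <;> norm_num
  · -- `substF` of the forms
    show substF n (if i.val = 1 then C (-3) * X (chainPos n ⟨1, i1lt⟩) ^ 2 else cubicG h2 i) =
      if i.val = 1 then derivC (cubicDir h2) (cubicTest h2 ⟨1, i1lt⟩) + 2 * cubicTest h2 ⟨0, i0lt⟩ else cubicTest h2 i
    split_ifs with h1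
    · rw [← hG1']; simp only [map_add, map_mul, map_ofNat, substF_polarDeriv, substF_cubicG]
    · exact substF_cubicG h2 i
  · -- lower components vanish
    show homogeneousComponent j (if i.val = 1 then C (-3) * X (chainPos n ⟨1, i1lt⟩) ^ 2 else cubicG h2 i) = 0
    have hj' : j < if i.val = 1 then 2 else 1 := hj
    split_ifs at hj' ⊢ with h1
    · rw [homogeneousComponent_C_mul, homogeneousComponent_X_pow_two, if_neg (by omega), mul_zero]
    · have hj0 : j = 0 := by omega
      subst hj0
      rw [homogeneousComponent_zero, ← constantCoeff_eq, C_eq_zero]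
      unfold cubicG; split_ifs <;> simp [constantCoeff_X]
  · -- the initial forms `F₀ + α(y) F₁`, `−3 F₁²`, `F_{p_i}` isolate `0`
    have hval : ∀ i : Fin (n * n), i.val ≠ 0 → i.val ≠ 1 → F₀ (chainPos n i) = 0 := fun i hi0 hi1 => by
      have h := hF i
      simp only [hi1, if_false, cubicG, hi0, homogeneousComponent_one_X', map_X, eval_X, Pi.zero_apply] at h
      exact h
    have h1 : F₀ (chainPos n ⟨1, i1lt⟩) = 0 := by
      have h := hF ⟨1, i1lt⟩
      simp only [if_true, homogeneousComponent_C_mul, homogeneousComponent_X_pow_two, map_mul, map_C, map_pow,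
        map_X, eval_C, eval_X, Pi.zero_apply] at h
      simp only [map_neg, map_ofNat] at h
      norm_num at h
      exact h
    have h0 : F₀ (chainPos n ⟨0, i0lt⟩) = 0 := by
      have h := hF ⟨0, i0lt⟩
      simp only [show (0 : ℕ) ≠ 1 from by norm_num, if_false, cubicG, if_true, map_add, homogeneousComponent_C_mul,
        homogeneousComponent_one_X', map_mul, map_C, map_X, eval_C, eval_X, Pi.zero_apply, mul_zero,
        add_zero, h1] at h
      exact h
    funext q
    exact chainPos_cases₂ h2 (P := fun q => F₀ q = 0) h0 h1 hval q

/-- **TWO ROUNDS ALONG `v` REACH ORDER ONE** over every base pair: the second deflation contains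
`D_v D_v t₁ = 6 f_{p₁}`. -/
theorem cubic_two_rounds_order_one (h2 : 2 ≤ n * n) {E : EqSystem n}
    (hfrom : ∀ i, ∃ j ∈ E.tests, E.testPoly j = cubicTest h2 i)
    {E' E'' : EqSystem n} (hD : E.DeflatesTo (cubicDir h2) E') (hD' : E'.DeflatesTo (cubicDir h2) E'')
    (y : MatMulVars n → ℂ) : E''.IdealInitIsolatedAt 1 y := by
  classical
  have i0lt : 0 < n * n := by omega
  have i1lt : 1 < n * n := by omega
  have hG6 : polarDeriv (cubicDir h2) (polarDeriv (cubicDir h2) (cubicG h2 ⟨1, i1lt⟩)) =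
      C 6 * X (chainPos n ⟨1, i1lt⟩) := by
    rw [polarDeriv_polarDeriv_cubicDir_cubicG_one, map_ofNat]
  refine ⟨n * n, fun i => if i.val = 1 then derivC (cubicDir h2) (derivC (cubicDir h2) (cubicTest h2 ⟨1, i1lt⟩))
      else cubicTest h2 i, fun i => ?_, fun _ => 1,
    fun i => if i.val = 1 then C 6 * X (chainPos n ⟨1, i1lt⟩) else cubicG h2 i, fun _ => le_rfl, fun i => ?_,
    fun i j hj => ?_, fun F₀ hF => ?_⟩
  · dsimp only
    split_ifs with h1
    · obtain ⟨j, hj, hji⟩ := hfrom ⟨1, i1lt⟩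
      obtain ⟨j', hj', h'⟩ := hD.2 j hj
      obtain ⟨j'', hj'', h''⟩ := hD'.2 j' hj'
      exact E''.mem_span_tests_of_mem ⟨j'', hj'', by rw [h'', h', hji]⟩
    · obtain ⟨j, hj, hji⟩ := hfrom i
      obtain ⟨j', hj', h'⟩ := hD.1 j hj
      obtain ⟨j'', hj'', h''⟩ := hD'.1 j' hj'
      exact E''.mem_span_tests_of_mem ⟨j'', hj'', by rw [h'', h', hji]⟩
  · show substF n (if i.val = 1 then C 6 * X (chainPos n ⟨1, i1lt⟩) else cubicG h2 i) =
      if i.val = 1 then derivC (cubicDir h2) (derivC (cubicDir h2) (cubicTest h2 ⟨1, i1lt⟩)) else cubicTest h2 i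
    split_ifs with h1
    · rw [← hG6, substF_polarDeriv, substF_polarDeriv, substF_cubicG]
    · exact substF_cubicG h2 i
  · have hj0 : j = 0 := by simp only at hj; omega
    subst hj0
    show homogeneousComponent 0 (if i.val = 1 then C 6 * X (chainPos n ⟨1, i1lt⟩) else cubicG h2 i) = 0
    rw [homogeneousComponent_zero, ← constantCoeff_eq, C_eq_zero]
    split_ifs
    · simp [constantCoeff_X]
    · unfold cubicG; split_ifs <;> simp [constantCoeff_X]
  · have hval : ∀ i : Fin (n * n), i.val ≠ 0 → i.val ≠ 1 → F₀ (chainPos n i) = 0 := fun i hi0 hi1 => by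
      have h := hF i
      simp only [hi1, if_false, cubicG, hi0, homogeneousComponent_one_X', map_X, eval_X, Pi.zero_apply] at h
      exact h
    have h1 : F₀ (chainPos n ⟨1, i1lt⟩) = 0 := by
      have h := hF ⟨1, i1lt⟩
      simp only [if_true, homogeneousComponent_C_mul, homogeneousComponent_one_X', map_mul, map_C, map_X, eval_C,
        eval_X, Pi.zero_apply, mul_zero] at h
      simp only [map_ofNat] at h
      norm_num at h
      exact h
    have h0 : F₀ (chainPos n ⟨0, i0lt⟩) = 0 := by
      have h := hF ⟨0, i0lt⟩
      simp only [show (0 : ℕ) ≠ 1 from by norm_num, if_false, cubicG, if_true, map_add, homogeneousComponent_C_mul,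
        homogeneousComponent_one_X', map_mul, map_C, map_X, eval_C, eval_X, Pi.zero_apply, mul_zero,
        add_zero, h1] at h
      exact h
    funext q
    exact chainPos_cases₂ h2 (P := fun q => F₀ q = 0) h0 h1 hval q

/-- **THE KERNEL-FIELD ORDERS AT DEGREE FOUR.**  One round: order `1` is refuted (`K ≤ 1`), order `2`
stands — the cubic specimen itself satisfies the clause of `KernelFieldClauseDeg 4 2` over every base
pair with the base-quadratic field `v`, and `KernelFieldClauseDeg 4 2 → ω₄ = ω` (M76). -/
theorem degree_four_kernelField_orders (h2 : 2 ≤ n * n) :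
    (∀ K ≤ 1, ¬ KernelFieldClauseDeg 4 K) ∧
    (∃ E : EqSystem n, E.Correct ∧ E.IsDegLe 4 ∧ (∀ K, K < 3 → ∀ y, ¬ E.IdealInitIsolatedAt K y) ∧
      (∀ j ∈ E.tests, derivC (cubicDir h2) (E.testPoly j) ∈ graphIdeal n) ∧
      (∀ E', E.DeflatesTo (cubicDir h2) E' → ∀ y, E'.IdealInitIsolatedAt 2 y) ∧
      ∀ E' E'', E.DeflatesTo (cubicDir h2) E' → E'.DeflatesTo (cubicDir h2) E'' → ∀ y, E''.IdealInitIsolatedAt 1 y) ∧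
    (KernelFieldClauseDeg 4 2 → EquationsForceMultiplicationDeg 4) := by
  obtain ⟨E, hE, hdeg, hto, hfrom, hmask, -⟩ := exists_cubicSystem h2
  refine ⟨fun K hK => not_kernelFieldClauseDeg_four_le_one hK,
    ⟨E, hE, hdeg, hmask, fun j hj => ?_, fun E' hD => cubic_one_round_order_two h2 hfrom hD,
      fun E' E'' hD hD' => cubic_two_rounds_order_one h2 hfrom hD hD'⟩,
    fun h => efmDeg_of_kernelFieldClauseDeg h le_rfl⟩
  obtain ⟨i, hi⟩ := hto j hj
  rw [hi]; exact cubicDir_kernel h2 i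

end Summit.MatrixMultiplication.MatrixMultiplication.Theorems.GraphEquations

end
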